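import Literature.NumberTheory.GaloisRepresentations.ContinuousShapiroLiftCores
import Literature.NumberTheory.EllipticCurves.SubgroupKummerClass
import Literature.NumberTheory.EllipticCurves.WeilPairingTateDual
import Literature.NumberTheory.EllipticCurves.WeilPairingLevelCompatProofs
import Literature.NumberTheory.GaloisCohomology.LocalInvariantMap
import Literature.NumberTheory.EllipticCurves.Kobayashi2003.SignedSelmer
import Literature.NumberTheory.EllipticCurves.Kato2004.IwasawaH1ReductionPk
import HarnessLib

/-!
# The local Tate pairing at the LAYERS of a cyclotomic `ℤ_p`-tower, in the Shapiro model
# (`⟨x, Q⟩_{n,N} = inv_v(Sh_n(loc_n x) ∪_{Σe} Sh_n(κ_{U_n}(Q))) ∈ ℤ/N`), and the `p`-power Weil tower of the tree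

Topic `NumberTheory/EllipticCurves` (namespace = path, sub-namespace `CyclotomicLayer` names the object). Width seat
`bsd-wall-tp2-p2x-w3` g5 (cell `bsd-wall`). DEFINITIONS WITH BODIES and unfolding lemmas only: no named fact, no instance, no
notation, no `sorry`. Nothing here is specific to any summit; BSD is not proved by any of this.

## What is here, and why it is a Literature file

For an elliptic curve `W/ℚ`, a level `N ≥ 1` with bilinear Galois-equivariant `μ_N`-valued Weil data `e` on `E[N]`, a `ℤ_p`-extension
`κ` of `ℚ` and a finite place `v`, the FINITE-COEFFICIENT LOCAL TATE PAIRING AT THE `n`-TH LAYER `ℚ_{n,v} = ℚ_n·ℚ_v`,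
`H¹(Γ_n, E[N]) × E(ℚ_{n,v}) → ℤ/N`, built from objects the tree already has for FINITE modules — localisation to `U_n = Gal(ℚ̄_v/ℚ_{n,v})`,
the Shapiro isomorphism `H¹(U_n, ·) ≅ H¹(Γ_v, Maps(Γ_v⧸U_n, ·))` (`shapiroLift`), the cup product for the summed Weil pairing
(`ContPairing.coindFin`), the Kummer map of `E(ℚ_{n,v})` (`subgroupKummerMap`) and THE local invariant map of `ℚ_v` (`localInvariantMap`):
§1 `torsionLocalRep`, `muLocalRep`, `weilLocalPairing`, `invAt`; §2 `layerGroup`, `layerReps`, `layerFintypeQuot`, `layerLoc`, `layerShapiro`,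
`layerConj`; §3 `layerSumPairing`, `layerKummer`, **`layerPairingMod`** (+ `_apply`); §4 on `T_pW`: **`layerPairingPk n k = layerPairingMod (p^k) ∘
Kato2004.reduceH1Pk`** (+ `_apply`); §5 THE Weil pairings of the tree on the `p`-power torsion, **`weilTowerPk k := weilPairingFun` at level `p^k`**,
with `_pow/_add_left/_add_right/_smul` and the one-step level compatibility `weilTowerPk_succ_of_coe_eq` (Silverman III.8.1 (e)).
This is Kobayashi's `( , )_n` modulo `N` / Perrin-Riou's layer pairing (§3.6.1), i.e. standard mathematics (Milne ADT I §3, §6);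
it was first written Summits-side for crux K3 of `Summits/BirchSwinnertonDyer` (`Theorems/ThetaPartnerAtTwoSignedKatoUpToAtTwoLayerPairingModDefs.lean`,
`…LayerPairingPk.lean`, `…LayerPairingCompat.lean`, width seat w3 g4; those files stay, append-only) and is VENDORED HERE VERBATIM (same
bodies, same names under `CyclotomicLayer`) so that LITERATURE named facts — the explicit reciprocity law at `p` for Kato's zeta element read on
THIS pairing (Kato Thm. 12.5 + Kobayashi Thm. 6.3 / Otsuki 2009), which a Literature file must state without importing `Summits` — can name
THE pairing; the Summits-side bridge is `rfl` (parallel bodies). Design: representatives of `Γ_v ⧸ U_n` are CHOSEN (`layerReps`,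
`Classical.choose`); the resulting maps on classes do not depend on the choice (`shapiroLift_eq_of_reps`). NOT here: the projection
formula (P1) / Galois invariance (P2) / level compatibility and the `ℤ_p`-adic limit `pair` (Summits-side theorems for now), any
reciprocity law, any named fact.

References: [Kobayashi2003] (8.23) (p. 18); [PerrinRiou1994Invent] §3.6.1; [Kato2004Asterisque] §12.2, §13.8; [MilneADT2006] I §2, I §3,
I §6 (proof of Prop. 6.9); [NeukirchSchmidtWingberg2008] I §5–§6; [SerreLocalFields1979] VII §5; [SilvermanAEC2009] III.8.1, VIII §2, X §4.
-/

set_option autoImplicit false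

noncomputable section

open scoped Classical

namespace Literature.NumberTheory.EllipticCurves

namespace CyclotomicLayer

-- `_root_.WeierstrassCurve`: inside `namespace Literature.NumberTheory.EllipticCurves` a bare `open WeierstrassCurve` would open the
-- directory-shadowed sub-namespace only (CONVENTIONS §2); `geomPoints`/`geomTorsion`/`weilPairingFun` live in Mathlib's root namespace.
open CategoryTheory Field NumberField IsDedekindDomain _root_.WeierstrassCurve
  Literature.NumberTheory.GaloisRepresentations
  Literature.NumberTheory.EllipticCurves.Kobayashi2003
  Literature.NumberTheory.EllipticCurves.Kato2004 Literature.NumberTheory.EllipticCurves.Kato2004.EulerSystemValues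
  Literature.NumberTheory.GaloisCohomology ZpExtension

-- Cup products need `LocallyCompactSpace Γ`; as in `WeilPairingTateDual.lean` the compactness of absolute Galois groups is a
-- local instance only (a Prop-valued Mathlib class, no data).
attribute [local instance] absoluteGaloisGroup_compactSpace

variable (W : WeierstrassCurve ℚ) [W.IsElliptic] (N : ℕ) [NeZero N]
  (e : geomTorsion W N → geomTorsion W N → AlgebraicClosure ℚ)
  (hμ : ∀ S T, e S T ^ N = 1)
  (hadd₁ : ∀ S₁ S₂ T, e (S₁ + S₂) T = e S₁ T * e S₂ T)
  (hadd₂ : ∀ S T₁ T₂, e S (T₁ + T₂) = e S T₁ * e S T₂)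
  (hgal : ∀ (σ : absoluteGaloisGroup ℚ) (S T : geomTorsion W N), σ • e S T = e (σ • S) (σ • T))
  {p : ℕ} [Fact p.Prime] (κ : ZpExtension ℚ p) (v : HeightOneSpectrum (𝓞 ℚ))

-- `E[N]` is finite (a local instance, as in the Summits-side original and `WeilPairingTateDual.lean`).
attribute [local instance] finite_geomTorsion_of_neZero

/-! ## §1 The local coefficient modules and the local Weil pairing at `ℚ_v` -/

/-- `E[N](ℚ̄)|_{Γ_v}`: the `N`-torsion of `W` as a discrete `Γ_{ℚ_v}`-module (restriction along `Γ_{ℚ_v} → Γ_ℚ` for the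
chosen embedding), as a `TopRep` — the coefficients of `KummerSelmerStructure`/`SubgroupKummerClass`.
[cite: SilvermanAEC2009, X §4] -/
abbrev torsionLocalRep : TopRep ℤ (absoluteGaloisGroup (v.adicCompletion ℚ)) :=
  DiscreteGaloisModule.toTopRep (GaloisRep.restrictField (v.adicCompletion ℚ) (W.torsionGaloisModule (N : ℤ)))

/-- `μ_N(ℚ̄)|_{Γ_v}` as a `TopRep` (the coefficients of `localInvariantMap ℚ N v`). [cite: MilneADT2006, Ch. I §2] -/
abbrev muLocalRep : TopRep ℤ (absoluteGaloisGroup (v.adicCompletion ℚ)) :=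
  DiscreteGaloisModule.toTopRep (GaloisRep.restrictField (v.adicCompletion ℚ) (DiscreteGaloisModule.mu ℚ N))

/-- **The local Weil pairing** `E[N]| × E[N]| → μ_N|` at `ℚ_v` as a continuous equivariant pairing (the tree's
`weilContPairingLocal` at the `ℚ`-field `ℚ_v`). [cite: MilneADT2006, Ch. I §6, proof of Prop. 6.9] [cite: SilvermanAEC2009, III §8] -/
def weilLocalPairing : ContPairing (torsionLocalRep W N v) (torsionLocalRep W N v) (muLocalRep N v) :=
  DiscreteGaloisModule.pairing (GaloisRep.restrictField (v.adicCompletion ℚ) (W.torsionGaloisModule (N : ℤ)))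
    (GaloisRep.restrictField (v.adicCompletion ℚ) (W.torsionGaloisModule (N : ℤ)))
    (GaloisRep.restrictField (v.adicCompletion ℚ) (DiscreteGaloisModule.mu ℚ N)) (weilPairingHom W N e hμ hadd₁ hadd₂) fun σ S T =>
      (weilContPairing W N e hμ hadd₁ hadd₂ hgal).toLin_smul (absGaloisRestrict ℚ (v.adicCompletion ℚ) σ) S T

omit [W.IsElliptic] in
/-- Unfolding `weilLocalPairing`: its bilinear map is `weilPairingHom`. [cite: SilvermanAEC2009, III §8] -/
@[simp] theorem weilLocalPairing_toLin_apply (S T : geomTorsion W N) :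
    (weilLocalPairing W N e hμ hadd₁ hadd₂ hgal v).toLin S T = weilPairingHom W N e hμ hadd₁ hadd₂ S T := rfl

/-- **THE local invariant map at `v`, read on `H²(Γ_{ℚ_v}, μ_N|)`** (`localInvariantMap ℚ N v`; the completion
`Place.Completion (Sum.inr v)` of the Poitou–Tate dialect is `v.adicCompletion ℚ` definitionally). [cite: MilneADT2006, Ch. I §1, Cor. 2.3] -/
def invAt : continuousCohomology 2 (muLocalRep N v) →+ ZMod N :=
  localInvariantMap ℚ N v

/-! ## §2 The layer groups `U_n ≤ Γ_v`, representatives, localisation, Shapiro -/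

/-- `U_n = Gal(ℚ̄_v/ℚ_{n,v})`: the local subgroup of the `n`-th layer `Γ_n` of `κ` for the chosen embedding
(`= localLayerSubgroupOfEmb κ (closureEmb ℚ_v) n`). [cite: Kobayashi2003, Def. 1.1] -/
abbrev layerGroup (n : ℕ) : Subgroup (absoluteGaloisGroup (v.adicCompletion ℚ)) :=
  localSubgroupOfEmb (κ.layerSubgroup n) (closureEmb (K := ℚ) (v.adicCompletion ℚ))

/-- `U_n` is normal in `Γ_v` (preimage of the normal subgroup `Γ_n ⊴ Γ_ℚ`). [cite: Kobayashi2003, Def. 1.1] -/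
theorem normal_layerGroup (n : ℕ) : (layerGroup κ v n).Normal :=
  Subgroup.Normal.comap inferInstance _

/-- `U_n` is open. [cite: Kobayashi2003, Def. 1.1] -/
theorem isOpen_layerGroup (n : ℕ) : IsOpen (layerGroup κ v n : Set (absoluteGaloisGroup (v.adicCompletion ℚ))) :=
  (κ.isOpen_layerSubgroup n).preimage (map_continuous (resGalOfEmb _))

/-- A chosen system of representatives of `Γ_v ⧸ U_n` with `s(1·U_n) = 1` (any other gives the same maps on classes:
`shapiroLift_eq_of_reps`). [cite: NeukirchSchmidtWingberg2008, I §5] -/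
def layerReps (n : ℕ) : absoluteGaloisGroup (v.adicCompletion ℚ) ⧸ layerGroup κ v n → absoluteGaloisGroup (v.adicCompletion ℚ) :=
  Classical.choose (exists_reps_one (layerGroup κ v n))

/-- `layerReps` are representatives. [cite: NeukirchSchmidtWingberg2008, I §5] -/
theorem layerReps_spec (n : ℕ) (x : absoluteGaloisGroup (v.adicCompletion ℚ) ⧸ layerGroup κ v n) :
    (layerReps κ v n x : absoluteGaloisGroup (v.adicCompletion ℚ) ⧸ layerGroup κ v n) = x :=
  (Classical.choose_spec (exists_reps_one (layerGroup κ v n))).1 x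

/-- `layerReps (1·U_n) = 1`. [cite: NeukirchSchmidtWingberg2008, I §5] -/
theorem layerReps_one (n : ℕ) :
    layerReps κ v n ((1 : absoluteGaloisGroup (v.adicCompletion ℚ)) : absoluteGaloisGroup (v.adicCompletion ℚ) ⧸ layerGroup κ v n) = 1 :=
  (Classical.choose_spec (exists_reps_one (layerGroup κ v n))).2

/-- `Γ_v ⧸ U_n` is finite (`U_n` open in the compact `Γ_v`): a `Fintype` structure, as a definition (used uniformly by
the constructions below, so that all of them carry the same instance term). [cite: SerreLocalFields1979, VII §5] -/
@[reducible]
def layerFintypeQuot (n : ℕ) : Fintype (absoluteGaloisGroup (v.adicCompletion ℚ) ⧸ layerGroup κ v n) :=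
  haveI : (layerGroup κ v n).FiniteIndex := finiteIndex_of_isOpen_of_compactSpace _ (isOpen_layerGroup κ v n)
  Fintype.ofFinite _

/-- **Localisation at the layer**: `loc_n : H¹(Γ_n, E[N]) → H¹(U_n, E[N]|)`, pull-back along `U_n → Γ_n`
(`resGalSubgroupOfEmb`), identity on coefficients. [cite: Kobayashi2003, (8.23) (p. 18)] -/
def layerLoc (n : ℕ) :
    H1 (W.torsionGaloisModule (N : ℤ)) (κ.layerSubgroup n) ⟶
      continuousCohomology 1 (subgroupRep (torsionLocalRep W N v) (layerGroup κ v n)) :=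
  ContinuousCohomology.map (resGalSubgroupOfEmb (κ.layerSubgroup n) (closureEmb (K := ℚ) (v.adicCompletion ℚ)))
    (X := subgroupRep (W.torsionGaloisModule (N : ℤ)).toTopRep (κ.layerSubgroup n))
    (Y := subgroupRep (torsionLocalRep W N v) (layerGroup κ v n))
    (TopRep.ofHom ⟨ContinuousLinearMap.id ℤ (geomTorsion W N), fun _ => rfl⟩) 1

/-- **The Shapiro isomorphism at the layer**: `Sh_n : H¹(U_n, E[N]|) →ₗ[ℤ] H¹(Γ_v, Maps(Γ_v ⧸ U_n, E[N]|))`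
(`shapiroLift` for the chosen representatives). [cite: NeukirchSchmidtWingberg2008, I §6 Prop. (1.6.4)] -/
def layerShapiro (n : ℕ) :
    continuousCohomology 1 (subgroupRep (torsionLocalRep W N v) (layerGroup κ v n)) →ₗ[ℤ]
      continuousCohomology 1 (coindFin.{0, 0} (torsionLocalRep W N v) (layerGroup κ v n)) :=
  shapiroLift (torsionLocalRep W N v) (layerGroup κ v n) (isOpen_layerGroup κ v n) (layerReps_spec κ v n)
    (layerReps_one κ v n)

/-- **The conjugation action of `g ∈ Γ_v` on `H¹(U_n, E[N]|)`** (`conjMap` of `ContinuousCorestriction.lean`, with the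
normality of `U_n` supplied). [cite: SerreLocalFields1979, VII §5] -/
def layerConj (n : ℕ) (g : absoluteGaloisGroup (v.adicCompletion ℚ)) :
    continuousCohomology 1 (subgroupRep (torsionLocalRep W N v) (layerGroup κ v n)) ⟶
      continuousCohomology 1 (subgroupRep (torsionLocalRep W N v) (layerGroup κ v n)) :=
  haveI := normal_layerGroup κ v n
  conjMap (torsionLocalRep W N v) (layerGroup κ v n) g 1

/-! ## §3 The summed pairing and the layer pairing modulo `N` -/

/-- **The summed local Weil pairing at layer `n`**: `Maps(Γ_v ⧸ U_n, E[N]|) × Maps(Γ_v ⧸ U_n, E[N]|) → μ_N|`,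
`⟨φ, ψ⟩ = Σ_y e(φ y, ψ y)` (the tree's `ContPairing.coindFin`; `Γ_v ⧸ U_n` is finite: `U_n` open in the compact `Γ_v`).
[cite: NeukirchSchmidtWingberg2008, I §5 Prop. (1.5.3)(iv)] -/
def layerSumPairing (n : ℕ) :
    ContPairing (coindFin.{0, 0} (torsionLocalRep W N v) (layerGroup κ v n))
      (coindFin.{0, 0} (torsionLocalRep W N v) (layerGroup κ v n)) (muLocalRep N v) :=
  haveI : Fintype (absoluteGaloisGroup (v.adicCompletion ℚ) ⧸ layerGroup κ v n) := layerFintypeQuot κ v n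
  (weilLocalPairing W N e hμ hadd₁ hadd₂ hgal v).coindFin (layerGroup κ v n)

/-- **The Kummer map of the layer** `E(ℚ_{n,v}) →+ H¹(U_n, E[N]|)` (`subgroupKummerMap` of `SubgroupKummerClass.lean` for
`U = U_n`; `E(ℚ_{n,v}) = localLayerPointsOfEmb κ ι W n = E(ℚ̄_v)^{U_n}`). [cite: Kobayashi2003, §2 (p. 4)] [cite: SilvermanAEC2009, VIII §2] -/
def layerKummer (n : ℕ) :
    localLayerPointsOfEmb κ (closureEmb (K := ℚ) (v.adicCompletion ℚ)) W n →+
      continuousCohomology 1 (subgroupRep (torsionLocalRep W N v) (layerGroup κ v n)) :=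
  W.subgroupKummerMap (N : ℤ) (layerGroup κ v n) (by exact_mod_cast (NeZero.ne N))

/-- **The layer pairing modulo `N`** — the (D-layer) object at finite level:
`⟨x, Q⟩_{n,N} = inv_v( Sh_n(loc_n x) ∪_{Σe} Sh_n(κ_{U_n}(Q)) ) ∈ ℤ/N` for `x ∈ H¹(Γ_n, E[N])`, `Q ∈ E(ℚ_{n,v})`; bi-additive.
By Shapiro this is the local Tate pairing `inv_{ℚ_{n,v}}(loc x ∪_e κ(Q))` of the layer field with coefficients `E[N]`
(Kobayashi's `( , )_n` modulo `N`). [cite: Kobayashi2003, (8.23) (p. 18)] [cite: PerrinRiou1994Invent, §3.6.1]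
[cite: MilneADT2006, Ch. I §6, proof of Prop. 6.9] -/
def layerPairingMod (n : ℕ) :
    H1 (W.torsionGaloisModule (N : ℤ)) (κ.layerSubgroup n) →+
      (localLayerPointsOfEmb κ (closureEmb (K := ℚ) (v.adicCompletion ℚ)) W n →+ ZMod N) where
  toFun x := (invAt N v).comp
    ((((layerSumPairing W N e hμ hadd₁ hadd₂ hgal κ v n).cupProduct
        (layerShapiro W N κ v n (layerLoc W N κ v n x))).toAddMonoidHom.comp
      (layerShapiro W N κ v n).toAddMonoidHom).comp (layerKummer W N κ v n))
  map_zero' := by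
    ext Q
    simp only [map_zero, LinearMap.zero_apply, AddMonoidHom.coe_comp, Function.comp_apply,
      LinearMap.toAddMonoidHom_coe, AddMonoidHom.zero_apply]
  map_add' x y := by
    ext Q
    simp only [map_add, LinearMap.add_apply, AddMonoidHom.coe_comp, Function.comp_apply,
      LinearMap.toAddMonoidHom_coe, AddMonoidHom.add_apply]

/-- **Unfolding the layer pairing**: `⟨x, Q⟩_{n,N} = inv_v (Sh_n(loc_n x) ∪ Sh_n(κ_{U_n}(Q)))`.
[cite: Kobayashi2003, (8.23) (p. 18)] -/
theorem layerPairingMod_apply (n : ℕ) (x : H1 (W.torsionGaloisModule (N : ℤ)) (κ.layerSubgroup n))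
    (Q : localLayerPointsOfEmb κ (closureEmb (K := ℚ) (v.adicCompletion ℚ)) W n) :
    layerPairingMod W N e hμ hadd₁ hadd₂ hgal κ v n x Q =
      invAt N v ((layerSumPairing W N e hμ hadd₁ hadd₂ hgal κ v n).cupProduct
        (layerShapiro W N κ v n (layerLoc W N κ v n x)) (layerShapiro W N κ v n (layerKummer W N κ v n Q))) :=
  rfl

/-! ## §4 On `T_pW`: reduction modulo `p^k` and the layer pairings `layerPairingPk n k` -/

section TateModule

variable [ContinuousSMul ℤ_[p] (W.tateModule p)]
  (ePk : ∀ k : ℕ, geomTorsion W (p ^ k) → geomTorsion W (p ^ k) → AlgebraicClosure ℚ)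
  (hμPk : ∀ k S T, ePk k S T ^ (p ^ k) = 1)
  (hadd₁Pk : ∀ k S₁ S₂ T, ePk k (S₁ + S₂) T = ePk k S₁ T * ePk k S₂ T)
  (hadd₂Pk : ∀ k S T₁ T₂, ePk k S (T₁ + T₂) = ePk k S T₁ * ePk k S T₂)
  (hgalPk : ∀ k (σ : absoluteGaloisGroup ℚ) (S T : geomTorsion W (p ^ k)), σ • ePk k S T = ePk k (σ • S) (σ • T))

/-- **The layer pairings on `T_pW`-classes**: `layerPairingPk n k : H¹(Γ_n, T_pW) →+ (E(ℚ_{n,v}) →+ ℤ/p^k)`,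
`x ↦ ⟨red_{p^k} x, ·⟩_{n,p^k}` with `red_{p^k} = Kato2004.reduceH1Pk` (index `geomTorsion W ((p : ℤ)^k)`, definitionally the
`ℕ`-cast index of `layerPairingMod (p^k)`), for a family of Weil data `ePk k` on `E[p^k]`. Kobayashi's `( , )_n` modulo `p^k`.
[cite: Kobayashi2003, (8.23) (p. 18)] [cite: PerrinRiou1994Invent, §3.6.1] [cite: Kato2004Asterisque, §13.8 (pp. 228–229)] -/
def layerPairingPk (n k : ℕ) :
    H1 (tateRep W p) (κ.layerSubgroup n) →+
      (localLayerPointsOfEmb κ (closureEmb (K := ℚ) (v.adicCompletion ℚ)) W n →+ ZMod (p ^ k)) :=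
  haveI : NeZero (p ^ k) := ⟨pow_ne_zero k (Fact.out : p.Prime).ne_zero⟩
  (layerPairingMod W (p ^ k) (ePk k) (hμPk k) (hadd₁Pk k) (hadd₂Pk k) (hgalPk k) κ v n).comp
    (reduceH1Pk W p k (κ.layerSubgroup n))

/-- Unfolding `layerPairingPk`. [cite: Kobayashi2003, (8.23) (p. 18)] -/
theorem layerPairingPk_apply (n k : ℕ) (x : H1 (tateRep W p) (κ.layerSubgroup n)) :
    layerPairingPk W κ v ePk hμPk hadd₁Pk hadd₂Pk hgalPk n k x =
      haveI : NeZero (p ^ k) := ⟨pow_ne_zero k (Fact.out : p.Prime).ne_zero⟩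
      layerPairingMod W (p ^ k) (ePk k) (hμPk k) (hadd₁Pk k) (hadd₂Pk k) (hgalPk k) κ v n
        (reduceH1Pk W p k (κ.layerSubgroup n) x) :=
  rfl

end TateModule

/-! ## §5 THE Weil pairings of the tree on the `p`-power torsion: `weilTowerPk` -/

section WeilTower

omit [W.IsElliptic] in
/-- `p^k ≠ 0` in `ℚ` (the level hypothesis of `weilPairingFun`). [cite: SilvermanAEC2009, Prop. III.8.1] -/
theorem natCast_pow_prime_ne_zero (k : ℕ) : ((p ^ k : ℕ) : ℚ) ≠ 0 := by
  exact_mod_cast pow_ne_zero k (Fact.out : p.Prime).ne_zero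

omit [W.IsElliptic] [Fact p.Prime] in
/-- A `p^k`-torsion point is killed by `p^k` (`ℕ`-cast index). [cite: SilvermanAEC2009, Prop. III.8.1] -/
theorem zsmul_coe_geomTorsion_pow (k : ℕ) (S : geomTorsion W ((p ^ k : ℕ) : ℤ)) :
    ((p ^ k : ℕ) : ℤ) • (S : geomPoints W) = 0 :=
  (mem_geomTorsion_iff W _ _).mp S.2

/-- **THE Weil pairings of the tree on the `p`-power torsion**: `e_{p^k} := weilPairingFun` at level `m = p^k`
(`WeierstrassCurve.weilPairingFun`, Silverman III §8), as a family `ePk` for `layerPairingPk`. [cite: SilvermanAEC2009, Prop. III.8.1 (a)–(e)] -/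
def weilTowerPk : ∀ k : ℕ, geomTorsion W (p ^ k) → geomTorsion W (p ^ k) → AlgebraicClosure ℚ :=
  fun k S T => weilPairingFun (natCast_pow_prime_ne_zero (p := p) k) (S : geomPoints W) (T : geomPoints W)

/-- Unfolding `weilTowerPk`. [cite: SilvermanAEC2009, Prop. III.8.1] -/
theorem weilTowerPk_apply (k : ℕ) (S T : geomTorsion W (p ^ k)) :
    weilTowerPk W k S T = weilPairingFun (natCast_pow_prime_ne_zero (p := p) k) (S : geomPoints W) (T : geomPoints W) := rfl

/-- `e_{p^k}(S,T)^{p^k} = 1` (`weilPairingFun_pow`). [cite: SilvermanAEC2009, Prop. III.8.1] -/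
theorem weilTowerPk_pow (k : ℕ) (S T : geomTorsion W (p ^ k)) : weilTowerPk W k S T ^ (p ^ k) = 1 :=
  weilPairingFun_pow (natCast_pow_prime_ne_zero (p := p) k) (zsmul_coe_geomTorsion_pow W k S) (zsmul_coe_geomTorsion_pow W k T)

/-- `e_{p^k}` is additive in `S` (`weilPairingFun_add_left`). [cite: SilvermanAEC2009, Prop. III.8.1 (a)] -/
theorem weilTowerPk_add_left (k : ℕ) (S₁ S₂ T : geomTorsion W (p ^ k)) :
    weilTowerPk W k (S₁ + S₂) T = weilTowerPk W k S₁ T * weilTowerPk W k S₂ T :=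
  weilPairingFun_add_left (natCast_pow_prime_ne_zero (p := p) k) (zsmul_coe_geomTorsion_pow W k S₁) (zsmul_coe_geomTorsion_pow W k S₂)
    (zsmul_coe_geomTorsion_pow W k T)

/-- `e_{p^k}` is additive in `T` (`weilPairingFun_add_right`). [cite: SilvermanAEC2009, Prop. III.8.1 (a)] -/
theorem weilTowerPk_add_right (k : ℕ) (S T₁ T₂ : geomTorsion W (p ^ k)) :
    weilTowerPk W k S (T₁ + T₂) = weilTowerPk W k S T₁ * weilTowerPk W k S T₂ :=
  weilPairingFun_add_right (natCast_pow_prime_ne_zero (p := p) k) (zsmul_coe_geomTorsion_pow W k S) (zsmul_coe_geomTorsion_pow W k T₁)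
    (zsmul_coe_geomTorsion_pow W k T₂)

/-- `e_{p^k}` is `Γ_ℚ`-equivariant (`weilPairingFun_smul`). [cite: SilvermanAEC2009, Prop. III.8.1 (d)] -/
theorem weilTowerPk_smul (k : ℕ) (σ : absoluteGaloisGroup ℚ) (S T : geomTorsion W (p ^ k)) :
    σ • weilTowerPk W k S T = weilTowerPk W k (σ • S) (σ • T) := by
  rw [weilTowerPk_apply, weilTowerPk_apply, Literature.NumberTheory.EllipticCurves.AddSubgroup.torsionBy.coe_smul,
    Literature.NumberTheory.EllipticCurves.AddSubgroup.torsionBy.coe_smul,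
    weilPairingFun_smul (natCast_pow_prime_ne_zero (p := p) k) σ (zsmul_coe_geomTorsion_pow W k S) (zsmul_coe_geomTorsion_pow W k T)]

/-- **Silverman III.8.1 (e), one step up the `p`-power tower**: `e_{p^{k+1}}(S', T') = e_{p^k}(S, T)` whenever `S = p • S'` and
`T' = T` in `E(ℚ̄)` — the one-step compatibility (WEIL) of the family `weilTowerPk` (`weilPairingFun_mul`; the levels `p^(k+1)` and
`p^k·p` agree definitionally). [cite: SilvermanAEC2009, Prop. III.8.1(e)] -/
theorem weilTowerPk_succ_of_coe_eq (k : ℕ) (S' : geomTorsion W (p ^ (k + 1))) (S : geomTorsion W (p ^ k))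
    (T' : geomTorsion W (p ^ (k + 1))) (T : geomTorsion W (p ^ k))
    (hS : (S : W.geomPoints) = (p : ℤ) • (S' : W.geomPoints)) (hT : (T' : W.geomPoints) = (T : W.geomPoints)) :
    weilTowerPk W (k + 1) S' T' = weilTowerPk W k S T := by
  have hpk1 : ((p ^ k * p : ℕ) : ℚ) ≠ 0 := by
    rw [← pow_succ]; exact natCast_pow_prime_ne_zero (p := p) (k + 1)
  have hS' : ((p ^ k * p : ℕ) : ℤ) • (S' : W.geomPoints) = 0 := by
    rw [← pow_succ]; exact zsmul_coe_geomTorsion_pow W (k + 1) S'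
  have hTk : ((p ^ k : ℕ) : ℤ) • (T : W.geomPoints) = 0 := zsmul_coe_geomTorsion_pow W k T
  rw [weilTowerPk_apply, weilTowerPk_apply, hT, hS]
  exact weilPairingFun_mul (natCast_pow_prime_ne_zero (p := p) k) hpk1 hS' hTk

/-- **THE `T_pW`-adic layer pairings of the tree, modulo `p^k`** — `layerPairingPk` for THE Weil pairings `weilTowerPk`:
`tatePairingPk n k : H¹(Γ_n, T_pW) →+ (E(ℚ_{n,v}) →+ ℤ/p^k)`. The residue clause «`PadicInt.toZModPow k (pair n x Q) = tatePairingPk n k x Q`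
for all `n k x Q`» PINS a family `pair n : H¹(Γ_n, T_pW) → Hom(E(ℚ_{n,v}), ℤ_p)` to THE `T_pW`-adic local Tate pairing of the layers.
[cite: Kobayashi2003, (8.23) (p. 18)] [cite: PerrinRiou1994Invent, §3.6.1] -/
def tatePairingPk [ContinuousSMul ℤ_[p] (W.tateModule p)] (n k : ℕ) :
    H1 (tateRep W p) (κ.layerSubgroup n) →+
      (localLayerPointsOfEmb κ (closureEmb (K := ℚ) (v.adicCompletion ℚ)) W n →+ ZMod (p ^ k)) :=
  layerPairingPk W κ v (weilTowerPk W) (weilTowerPk_pow W) (weilTowerPk_add_left W) (weilTowerPk_add_right W) (weilTowerPk_smul W) n k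

/-- Unfolding `tatePairingPk`. [cite: Kobayashi2003, (8.23) (p. 18)] -/
theorem tatePairingPk_eq [ContinuousSMul ℤ_[p] (W.tateModule p)] (n k : ℕ) :
    tatePairingPk W κ v n k =
      layerPairingPk W κ v (weilTowerPk W) (weilTowerPk_pow W) (weilTowerPk_add_left W) (weilTowerPk_add_right W)
        (weilTowerPk_smul W) n k := rfl

/-- **The residue clause PINS the `T_pW`-adic pairing**: two families `pair, pair' : ∀ n, H¹(Γ_n, T_pW) →ₗ[ℤ_p] Hom(E(ℚ_{n,v}), ℤ_p)`
whose residues modulo every `p^k` are `tatePairingPk` coincide (`ℤ_p` is `p`-adically separated: `PadicInt.ext_of_toZModPow`). So a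
named fact quantified over «every `pair` with these residues» speaks about ONE object, THE local Tate pairing of the layers. [folklore]
[cite: PerrinRiou1994Invent, §3.6.1] -/
theorem eq_of_forall_toZModPow_eq_tatePairingPk [ContinuousSMul ℤ_[p] (W.tateModule p)]
    {pair pair' : ∀ n : ℕ, H1 (tateRep W p) (κ.layerSubgroup n) →ₗ[ℤ_[p]]
      (localLayerPointsOfEmb κ (closureEmb (K := ℚ) (v.adicCompletion ℚ)) W n →+ ℤ_[p])}
    (h : ∀ (n k : ℕ) (x : H1 (tateRep W p) (κ.layerSubgroup n))
      (Q : localLayerPointsOfEmb κ (closureEmb (K := ℚ) (v.adicCompletion ℚ)) W n),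
      PadicInt.toZModPow k (pair n x Q) = tatePairingPk W κ v n k x Q)
    (h' : ∀ (n k : ℕ) (x : H1 (tateRep W p) (κ.layerSubgroup n))
      (Q : localLayerPointsOfEmb κ (closureEmb (K := ℚ) (v.adicCompletion ℚ)) W n),
      PadicInt.toZModPow k (pair' n x Q) = tatePairingPk W κ v n k x Q) :
    pair = pair' := by
  funext n
  refine LinearMap.ext fun x ↦ AddMonoidHom.ext fun Q ↦ ?_
  exact PadicInt.ext_of_toZModPow.mp fun k ↦ (h n k x Q).trans (h' n k x Q).symm

end WeilTower

end CyclotomicLayer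

end Literature.NumberTheory.EllipticCurves

end
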